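import Literature.AlgebraicGeometry.HodgeTheory.WeilSurfaceCMSquareModel
import Literature.AlgebraicGeometry.HodgeTheory.WeilSurfaceCMSquareAlgebraic
import Literature.AlgebraicGeometry.Motives.HyperbolicWeilTypeProductModel
import Literature.AlgebraicGeometry.Motives.WeilFormIsotropicBlockVectorsAll
import HarnessLib

/-!
# Towards `exists_weilTypeSurface_prod_isHyperbolicWeilType_all`: the assembly of the aiming (proved modulo its inputs)

Family `hodge`, layer `Literature/AlgebraicGeometry/HodgeTheory`. Sibling of `WeilClassesDescending`
(the named fact `exists_weilTypeSurface_prod_isHyperbolicWeilType_all`: Markman, arXiv:2509.23403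
§11.5 Step 2 in every even dimension; van Geemen, LNM 1594, Lemma 5.2 (2)–(4), 5.3, 5.4 (5.4.1);
Schoen 1998 §10; Landherr 1936), of `WeilClassesDescendingProofs` (surface half),
`WeilSurfaceCMSquare(Model, Algebraic)` (the print's CM partner `B = E₀ × E₀`, `Φ = ψ₀ × (-ψ₀)`,
its degree-one model, and — since the re-cut of the fact on 2026-08-16 — Schoen's descent partner:
its Weil lines are algebraic) and of the carrier core `Motives/HyperbolicWeilTypeProduct(Model)`,
`Motives/WeilFormIsotropicBlockVectors(All)` (hyperbolic frames of products from rational models;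
Landherr's aiming arithmetic via Meyer). This file ASSEMBLES these into the AIMING HALF of the
fact for the CM partner, proved modulo exactly its analytic and projective inputs, which enter as
explicit hypotheses / data:

* `isHyperbolicWeilType_prod_cmSquare_of_signature` — let `(A, φ)`, `dim A = 2n`, `φ ≫ φ = -d`,
  carry a rational class `H ∈ H²(A(ℂ); ℂ)` (intended: a hyperplane class) and put
  `h = d·H + φ^*H` (the `K`-symmetrised class, `φ^* h = d h`); let `(u, M, ω, G, d_A)` be a
  rational degree-one model of `(A, φ, h)` (`Motives/RationalDegreeOneModel`: such models exist)
  whose symmetric form `x ↦ G(x, Mx)` has SIGNATURE `(2n, 2n)` in the `M`-stable sense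
  (`M`-stable rational subspaces `P`, `N` of dimension `2n`, `P ∩ N = 0`, on which it is positive,
  resp. negative — Hodge–Riemann in degree one for the hyperplane class, van Geemen 5.2 (4), NOT
  proved here); let `(E₀, ψ₀)` be a CM curve (`dim E₀ = 1`, `ψ₀ ≫ ψ₀ = -d`) with a rational class
  `η ∈ H²(E₀(ℂ); ℂ)`. THEN there are positive integers `m₁, m₂` such that
  `(A × (E₀ × E₀), φ × (ψ₀ × (-ψ₀)))` is of hyperbolic Weil type in half-dimension `n + 1` for the
  class `d·K + (φ × Φ)^* K`, `K = pr_A^* H + pr_B^*(m₁·pr₁^*η + m₂·pr₂^*η)` — the `K`-symmetrised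
  class of the weighted product class. With `K = e^* a` for a projective embedding `e` of
  `A × (E₀ × E₀)` realising these weights (a weighted Segre embedding, NOT constructed here) this is
  verbatim the hyperbolicity conjunct of the fact.

Proof: `φ^* h = d h` (`(φ^*)² = d²` on `H²`, `complexBetti_map_map_two_of_comp_self`), so the model
is of Weil type and alternating (`gram_map_eq_mul_gram`, `gram_antisymm`) and `M² = -d`
(`mulVec_mulVec_eq_neg_smul_of_comp_self`); the CM curve has the model
`(M_E, G_E) = (((0,-d),(1,0)), ((0,1),(-1,0)))` in the frame `(v, ψ₀^* v)` with `η = t·(v ∪ ψ₀^*v)`,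
`(±ψ₀)^* = d` on `H²` (`cmCurve_rationalModel`); the aiming arithmetic
(`exists_isotropic_blockVectors'`, all cases) with the weights
`κ₁ = 8·C(2n+1, 2n-1)·d²t²`, `κ₂ = 2·C(2n+1, 2n)·d_A·d·t` returns `m₁, m₂` and `2n + 2` independent
isotropic vectors for `(κ₁ m₁ m₂)·G ⊕ (κ₂ m₂)·G_E ⊕ (κ₂ m₁)·G_E`, stable under `M ⊕ M_E ⊕ -M_E`;
this is EXACTLY the block Gram matrix of `pr_A^* h + pr_B^* h_B`,
`h_B = pr₁^*(2dm₁η) + pr₂^*(2dm₂η) = d·H_B + Φ^* H_B`, in the pulled-back frame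
(`polarizationPairingOne_sumElim`, `lefschetzPow_add_map_self` for `B = E₀ × E₀`, then
`isHyperbolicWeilType_prod_of_rationalModels` for `A × B`).

What is NOT here (the remaining inputs of the fact, each absent from the tree): (G2) the signature
`(2n, 2n)` of `G(x, Mx)` for `H` a hyperplane class (Hodge–Riemann in degree one); (G3) projective
embeddings of `A × (E₀ × E₀)` with `e^* a = pr_A^* H + pr_B^*(m₁ pr₁^*η + m₂ pr₂^*η)` for all
`m₁, m₂ ≥ 1` (weighted Segre embeddings and their hyperplane classes on `complexBetti`); (G4) a CM
elliptic curve `(E₀, ψ₀)`, `ψ₀ ≫ ψ₀ = -d`, as an abelian variety over `ℂ` with an endomorphism.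
Everything below is proved; no definition and no named fact is introduced (D-0026).

## References

* [vanGeemen1994HodgeAV] B. van Geemen, LNM 1594 (1994), Lemma 5.2 (2)–(4), 5.3, 5.4 (5.4.1).
* [Markman2025SurveySecant] E. Markman, arXiv:2509.23403, §11.5 Step 2.
* [Schoen1998HodgeWeilAddendum] C. Schoen, Compositio Math. 114 (1998), §10.
* [LangeBirkenhake1992] H. Lange, Ch. Birkenhake, Complex Abelian Varieties (1992), §5.3, Lemma 1.1.17.
-/

noncomputable section

open CategoryTheory

namespace Literature.AlgebraicGeometry.HodgeTheory

open Literature.AlgebraicTopology.SingularHomology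
open Literature.AlgebraicGeometry.Motives
open Literature.Geometry.Kaehler

section Coordinates

variable {A : Motives.AbelianVariety ℂ}

/-- **`M² = -d` for the matrix of `φ^*` in a rational frame** (`φ ≫ φ = -d`): the comparison
`x ↦ Σ xᵢ uᵢ` is injective on rational coefficient vectors (`linearIndependent_iff_of_isRationalClass`)
and intertwines `M` with `φ^*`, whose square is `-d` on `H¹` (`complexBetti_map_map_one_of_comp_self`).
[cite: vanGeemen1994HodgeAV, 4.9] -/
theorem mulVec_mulVec_eq_neg_smul_of_comp_self {ι : Type*} [Fintype ι]
    {d : ℕ} {φ : A ⟶ A} (hφ : φ ≫ φ = -(d • 𝟙 A))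
    {u : ι → complexBetti A.X 1} (hu : ∀ i, IsRationalClass (u i)) (hui : LinearIndependent ℂ u)
    (M : Matrix ι ι ℚ)
    (hM : ∀ i, complexBetti.map φ.hom.hom.hom 1 (u i) = ∑ a, ((M a i : ℚ) : ℂ) • u a)
    (x : ι → ℚ) : M.mulVec (M.mulVec x) = -((d : ℚ) • x) := by
  classical
  set T := (complexBetti.map φ.hom.hom.hom 1).hom with hT
  have hc : ∀ y : ι → ℚ, T (∑ i, ((y i : ℚ) : ℂ) • u i) = ∑ i, ((M.mulVec y i : ℚ) : ℂ) • u i := by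
    intro y
    simp only [map_sum, map_smul]
    change ∑ i, ((y i : ℚ) : ℂ) • complexBetti.map φ.hom.hom.hom 1 (u i) = _
    simp only [hM, Finset.smul_sum, smul_smul]
    rw [Finset.sum_comm]
    refine Finset.sum_congr rfl fun j _ => ?_
    rw [← Finset.sum_smul, Matrix.mulVec, dotProduct]
    push_cast
    simp_rw [mul_comm (((y _ : ℚ)) : ℂ)]
  have hu' := (linearIndependent_iff_of_isRationalClass hu).1 hui
  have h1 : T (T (∑ i, ((x i : ℚ) : ℂ) • u i)) = ∑ i, ((M.mulVec (M.mulVec x) i : ℚ) : ℂ) • u i := by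
    rw [hc, hc]
  have h2 : T (T (∑ i, ((x i : ℚ) : ℂ) • u i)) = ∑ i, (((-((d : ℚ) • x)) i : ℚ) : ℂ) • u i := by
    rw [complexBetti_map_map_one_of_comp_self hφ, Finset.smul_sum, ← Finset.sum_neg_distrib]
    refine Finset.sum_congr rfl fun i _ => ?_
    rw [smul_smul, ← neg_smul]
    congr 1
    simp
  have h3 : ∑ i, (((M.mulVec (M.mulVec x) i - (-((d : ℚ) • x)) i : ℚ)) : ℂ) • u i = 0 := by
    simp only [Rat.cast_sub, sub_smul, Finset.sum_sub_distrib]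
    rw [← h1, ← h2, sub_self]
  have h4 := hu' _ h3
  funext i
  have hi := congrFun h4 i
  simp only [Pi.neg_apply, Pi.smul_apply, Pi.zero_apply, smul_eq_mul, sub_neg_eq_add] at hi
  simp only [Pi.neg_apply, Pi.smul_apply, smul_eq_mul]
  linarith

/-- **`(φ^*)² = d²` on `H²(A(ℂ); ℂ)`** for `φ ≫ φ = -d`: `H²` is spanned by cup products of
degree-one classes (`H• = ⋀• H¹`, `HasExteriorCohomologyH1`), on which `(φ^*)² = (-d)·(-d)`.
[cite: vanGeemen1994HodgeAV, Lemma 5.2 (1)] [cite: LangeBirkenhake1992, Lemma 1.1.17] -/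
theorem complexBetti_map_map_two_of_comp_self {d : ℕ} {φ : A ⟶ A} (hφ : φ ≫ φ = -(d • 𝟙 A))
    (y : complexBetti A.X 2) :
    complexBetti.map φ.hom.hom.hom 2 (complexBetti.map φ.hom.hom.hom 2 y) = ((d : ℂ) ^ 2) • y := by
  classical
  have hspan := (surface_hasExteriorCohomologyH1 A).span_range_cupPowOne 2
  set T2 := (complexBetti.map φ.hom.hom.hom 2).hom with hT2
  set T := (complexBetti.map φ.hom.hom.hom 1).hom with hT
  have key : T2 ∘ₗ T2 = ((d : ℂ) ^ 2) • LinearMap.id := by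
    refine LinearMap.ext_on_range hspan fun v => ?_
    rw [LinearMap.comp_apply, LinearMap.smul_apply, LinearMap.id_apply, cupPowOne_succ, Fin.tail_def]
    simp only [cupPowOne_one]
    change complexBetti.map φ.hom.hom.hom 2 (complexBetti.map φ.hom.hom.hom 2
      (cupProduct _ (v 0) (v 1))) = _
    rw [show complexBetti.map φ.hom.hom.hom 2 (cupProduct (Nat.add_comm 1 1) (v 0) (v 1)) =
        cupProduct (Nat.add_comm 1 1) (T (v 0)) (T (v 1)) from cupProduct_map _ _ _ _,
      show complexBetti.map φ.hom.hom.hom 2 (cupProduct (Nat.add_comm 1 1) (T (v 0)) (T (v 1))) =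
        cupProduct (Nat.add_comm 1 1) (T (T (v 0))) (T (T (v 1))) from cupProduct_map _ _ _ _,
      complexBetti_map_map_one_of_comp_self hφ, complexBetti_map_map_one_of_comp_self hφ]
    simp only [map_neg, map_smul, LinearMap.neg_apply, LinearMap.smul_apply]
    rw [smul_neg, neg_neg, smul_smul, ← pow_two]
    rfl
  have := congrArg (fun f : complexBetti A.X 2 →ₗ[ℂ] complexBetti A.X 2 => f y) key
  simpa using this

/-- **`φ^*(d·H + φ^*H) = d·(d·H + φ^*H)`**: the `K`-symmetrised class of any `H ∈ H²` is an
eigenclass of `φ^*` (`(φ^*)² = d²`; van Geemen 5.2 (1): `E_K = d E + (√-d)^* E` satisfies the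
compatibility). [cite: vanGeemen1994HodgeAV, Lemma 5.2 (1)] -/
theorem map_ksymm_eq_smul {d : ℕ} {φ : A ⟶ A} (hφ : φ ≫ φ = -(d • 𝟙 A)) (H : complexBetti A.X 2) :
    complexBetti.map φ.hom.hom.hom 2 ((d : ℂ) • H + complexBetti.map φ.hom.hom.hom 2 H) =
      (d : ℂ) • ((d : ℂ) • H + complexBetti.map φ.hom.hom.hom 2 H) := by
  rw [map_add, map_smul, complexBetti_map_map_two_of_comp_self hφ, smul_add, smul_smul, pow_two,
    add_comm]

/-- The Weil-type identity of the Gram matrix, read on coefficient vectors: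
`Σ_{a,b} M_{ai} G_{ab} M_{bk} = d G_{ik}` gives `G(Mx, My) = d G(x, y)`. [folklore] -/
theorem dotProduct_mulVec_mulVec_of_gram {ι : Type*} [Fintype ι] (M G : Matrix ι ι ℚ) (d : ℚ)
    (hgram : ∀ i k, ∑ a, ∑ b, M a i * G a b * M b k = d * G i k) (x y : ι → ℚ) :
    M.mulVec x ⬝ᵥ G.mulVec (M.mulVec y) = d * (x ⬝ᵥ G.mulVec y) := by
  have hmat : M.transpose * G * M = d • G := by
    ext i k
    rw [Matrix.smul_apply, smul_eq_mul, ← hgram i k, Matrix.mul_apply]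
    simp only [Matrix.mul_apply, Matrix.transpose_apply, Finset.sum_mul]
    rw [Finset.sum_comm]
  calc M.mulVec x ⬝ᵥ G.mulVec (M.mulVec y)
      = x ⬝ᵥ (M.transpose.mulVec (G.mulVec (M.mulVec y))) := by
        rw [dotProduct_comm (M.mulVec x), Matrix.dotProduct_mulVec, Matrix.mulVec_transpose,
          dotProduct_comm]
    _ = x ⬝ᵥ (M.transpose * G * M).mulVec y := by rw [Matrix.mulVec_mulVec, Matrix.mulVec_mulVec]
    _ = d * (x ⬝ᵥ G.mulVec y) := by rw [hmat, Matrix.smul_mulVec, dotProduct_smul, smul_eq_mul]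

/-- Alternation of the Gram matrix, read on coefficient vectors. [folklore] -/
theorem dotProduct_mulVec_antisymm {ι : Type*} [Fintype ι] (G : Matrix ι ι ℚ)
    (hG : ∀ i k, G i k = -G k i) (x y : ι → ℚ) :
    y ⬝ᵥ G.mulVec x = -(x ⬝ᵥ G.mulVec y) := by
  have hmat : G.transpose = -G := by
    ext i k
    rw [Matrix.transpose_apply, Matrix.neg_apply, hG k i]
  calc y ⬝ᵥ G.mulVec x = x ⬝ᵥ G.transpose.mulVec y := by
        rw [Matrix.mulVec_transpose, Matrix.dotProduct_mulVec, dotProduct_comm]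
    _ = -(x ⬝ᵥ G.mulVec y) := by rw [hmat, Matrix.neg_mulVec, dotProduct_neg]

/-- A spanning independent frame of `H¹(A(ℂ); ℂ)` has `2 dim A` members (`b₁ = 2 dim A`).
[cite: LangeBirkenhake1992, §1.1 Prop. 1.1.9 (p. 20)] -/
theorem card_eq_of_frame {ι : Type*} [Fintype ι] {u : ι → complexBetti A.X 1}
    (hui : LinearIndependent ℂ u) (hus : Submodule.span ℂ (Set.range u) = ⊤) :
    Fintype.card ι = 2 * A.dim := by
  have b : Module.Basis ι ℂ (complexBetti A.X 1) := Module.Basis.mk hui (by rw [hus])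
  rw [← Module.finrank_eq_card_basis b, surface_finrank_complexBetti_one]

variable {B : Motives.AbelianVariety ℂ}

/-- The `K`-symmetrised class of a sum of pull-backs is the sum of the pull-backs of the
`K`-symmetrised classes: `c·(pr_A^*H_A + pr_B^*H_B) + (φ × ψ)^*(pr_A^*H_A + pr_B^*H_B) =
pr_A^*(c H_A + φ^* H_A) + pr_B^*(c H_B + ψ^* H_B)`. [folklore] -/
theorem smul_add_map_prodLift (φ : A ⟶ A) (ψ : B ⟶ B) (c : ℂ) (HA : complexBetti A.X 2)
    (HB : complexBetti B.X 2) :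
    c • (complexBetti.map (AbelianVariety.fst A B).hom.hom.hom 2 HA +
        complexBetti.map (AbelianVariety.snd A B).hom.hom.hom 2 HB) +
      complexBetti.map (AbelianVariety.prodLift (AbelianVariety.fst A B ≫ φ)
        (AbelianVariety.snd A B ≫ ψ)).hom.hom.hom 2
        (complexBetti.map (AbelianVariety.fst A B).hom.hom.hom 2 HA +
          complexBetti.map (AbelianVariety.snd A B).hom.hom.hom 2 HB) =
    complexBetti.map (AbelianVariety.fst A B).hom.hom.hom 2 (c • HA + complexBetti.map φ.hom.hom.hom 2 HA) +
      complexBetti.map (AbelianVariety.snd A B).hom.hom.hom 2 (c • HB + complexBetti.map ψ.hom.hom.hom 2 HB) := by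
  rw [map_add, map_prodLift_map_fst, map_prodLift_map_snd, map_add, map_add, map_smul, map_smul,
    smul_add]
  abel

end Coordinates

/-! ### The assembly -/

section Assembly

variable {A : Motives.AbelianVariety ℂ} {φ : A ⟶ A} {E₀ : Motives.AbelianVariety ℂ} {ψ₀ : E₀ ⟶ E₀}

/-- **The aiming half of the partner-surface lemma for the CM partner, proved modulo its
inputs.** Data: `n, d ≥ 1`; `(A, φ)` with `dim A = j + 1 = 2n`, `φ ≫ φ = -(d • 𝟙)`; a rational
class `H ∈ H²(A(ℂ); ℂ)` and `h = d·H + φ^*H`; a rational degree-one model of `(A, φ, h)` — a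
rational, independent, spanning frame `u` of `H¹(A(ℂ))` with the rational matrix `M` of `φ^*`, a
top class `ω ≠ 0`, the Gram matrix `G` of `Q_h(x, y) = hʲ ∪ x ∪ y` and the top power
`Lʲ_h h = d_A ω` — of SIGNATURE `(2n, 2n)` (hypothesis `hPN`); a CM curve `(E₀, ψ₀)`,
`dim E₀ = 1`, `ψ₀ ≫ ψ₀ = -(d • 𝟙)`, with a rational `η ∈ H²(E₀(ℂ); ℂ)`. Conclusion: for some
positive integers `m₁, m₂`, `(A × (E₀ × E₀), φ × (ψ₀ × (-ψ₀)))` is of hyperbolic Weil type in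
half-dimension `n + 1` for `d·K + (φ × (ψ₀ × (-ψ₀)))^* K`,
`K = pr_A^* H + pr_B^*(m₁·pr₁^*η + m₂·pr₂^*η)` (van Geemen 5.2 (2)–(4), 5.3, 5.4 (5.4.1); Markman
§11.5 Step 2; Schoen §10). Proof: module docstring. [cite: vanGeemen1994HodgeAV, Lemma 5.2 (2)–(4), 5.3 and 5.4 (5.4.1)]
[cite: Markman2025SurveySecant, §11.5 Step 2] [cite: Schoen1998HodgeWeilAddendum, §10] -/
theorem isHyperbolicWeilType_prod_cmSquare_of_signature
    {n d : ℕ} (hd : 0 < d) {j : ℕ} (hA : A.dim = j + 1) (hj : j + 1 = 2 * n)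
    (hφ : φ ≫ φ = -(d • 𝟙 A)) (H : complexBetti A.X 2)
    (hE : E₀.dim = 1) (hψ : ψ₀ ≫ ψ₀ = -(d • 𝟙 E₀)) (η : complexBetti E₀.X 2) (hη : IsRationalClass η)
    {ι : Type} [Fintype ι] [DecidableEq ι]
    (u : ι → complexBetti A.X 1) (hu : ∀ i, IsRationalClass (u i)) (hui : LinearIndependent ℂ u)
    (hus : Submodule.span ℂ (Set.range u) = ⊤) (M : Matrix ι ι ℚ)
    (hM : ∀ i, complexBetti.map φ.hom.hom.hom 1 (u i) = ∑ a, ((M a i : ℚ) : ℂ) • u a)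
    (ω : complexBetti A.X (2 + 2 * j)) (hω0 : ω ≠ 0) (G : Matrix ι ι ℚ)
    (hG : ∀ i k, Motives.polarizationPairingOne A.X ((d : ℂ) • H + complexBetti.map φ.hom.hom.hom 2 H) j
      (u i) (u k) = ((G i k : ℚ) : ℂ) • ω)
    (dA : ℚ) (hdA : lefschetzPow ((d : ℂ) • H + complexBetti.map φ.hom.hom.hom 2 H) j 2
      ((d : ℂ) • H + complexBetti.map φ.hom.hom.hom 2 H) = ((dA : ℚ) : ℂ) • ω)
    (hPN : ∃ P N : Submodule ℚ (ι → ℚ), (∀ v ∈ P, M.mulVec v ∈ P) ∧ (∀ v ∈ N, M.mulVec v ∈ N) ∧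
      Module.finrank ℚ P = 2 * n ∧ Module.finrank ℚ N = 2 * n ∧ P ⊓ N = ⊥ ∧
      (∀ x ∈ P, x ≠ 0 → 0 < x ⬝ᵥ G.mulVec (M.mulVec x)) ∧
      (∀ x ∈ N, x ≠ 0 → x ⬝ᵥ G.mulVec (M.mulVec x) < 0)) :
    ∃ m₁ m₂ : ℕ, 0 < m₁ ∧ 0 < m₂ ∧
      Motives.IsHyperbolicWeilType (A.prod (E₀.prod E₀))
        (AbelianVariety.prodLift (AbelianVariety.fst A (E₀.prod E₀) ≫ φ)
          (AbelianVariety.snd A (E₀.prod E₀) ≫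
            AbelianVariety.prodLift (AbelianVariety.fst E₀ E₀ ≫ ψ₀) (AbelianVariety.snd E₀ E₀ ≫ (-ψ₀))))
        (n + 1)
        ((d : ℂ) • (complexBetti.map (AbelianVariety.fst A (E₀.prod E₀)).hom.hom.hom 2 H +
            complexBetti.map (AbelianVariety.snd A (E₀.prod E₀)).hom.hom.hom 2
              ((m₁ : ℂ) • complexBetti.map (AbelianVariety.fst E₀ E₀).hom.hom.hom 2 η +
                (m₂ : ℂ) • complexBetti.map (AbelianVariety.snd E₀ E₀).hom.hom.hom 2 η)) +
          complexBetti.map (AbelianVariety.prodLift (AbelianVariety.fst A (E₀.prod E₀) ≫ φ)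
            (AbelianVariety.snd A (E₀.prod E₀) ≫
              AbelianVariety.prodLift (AbelianVariety.fst E₀ E₀ ≫ ψ₀)
                (AbelianVariety.snd E₀ E₀ ≫ (-ψ₀)))).hom.hom.hom 2
            (complexBetti.map (AbelianVariety.fst A (E₀.prod E₀)).hom.hom.hom 2 H +
              complexBetti.map (AbelianVariety.snd A (E₀.prod E₀)).hom.hom.hom 2
                ((m₁ : ℂ) • complexBetti.map (AbelianVariety.fst E₀ E₀).hom.hom.hom 2 η +
                  (m₂ : ℂ) • complexBetti.map (AbelianVariety.snd E₀ E₀).hom.hom.hom 2 η))) := by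
  classical
  -- notation
  set B := E₀.prod E₀ with hB
  set ΦB : B ⟶ B := AbelianVariety.prodLift (AbelianVariety.fst E₀ E₀ ≫ ψ₀)
    (AbelianVariety.snd E₀ E₀ ≫ (-ψ₀)) with hΦB
  set h : complexBetti A.X 2 := (d : ℂ) • H + complexBetti.map φ.hom.hom.hom 2 H with hh_def
  have hX : Motives.IsSmoothProjective (j + 1) A.X := isSmoothProjective_of_dim_eq' hA
  have hBdim : B.dim = 1 + 1 := by rw [hB, AbelianVariety.dim_prod, hE]
  have hdq : (0 : ℚ) < d := by exact_mod_cast hd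
  -- the `A`-side coordinate identities
  have hMA : ∀ x, M.mulVec (M.mulVec x) = -((d : ℚ) • x) :=
    mulVec_mulVec_eq_neg_smul_of_comp_self hφ hu hui M hM
  have hh : complexBetti.map φ.hom.hom.hom 2 h = (d : ℂ) • h := map_ksymm_eq_smul hφ H
  have hgram := gram_map_eq_mul_gram hA (surface_finrank_complexBetti_one A)
    ((surface_hasExteriorCohomologyH1 A).span_range_cupPowOne (2 + 2 * j)) hd hφ hh u M hM hω0 G hG
  have hWA : ∀ x y : ι → ℚ, M.mulVec x ⬝ᵥ G.mulVec (M.mulVec y) = (d : ℚ) * (x ⬝ᵥ G.mulVec y) :=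
    dotProduct_mulVec_mulVec_of_gram M G d hgram
  have hGt : ∀ x y : ι → ℚ, y ⬝ᵥ G.mulVec x = -(x ⬝ᵥ G.mulVec y) :=
    dotProduct_mulVec_antisymm G (gram_antisymm h j u hω0 G hG)
  have hcard : Fintype.card ι = 4 * n := by rw [card_eq_of_frame hui hus, hA]; omega
  -- the CM curve: its model in the frame `(v, ψ₀^* v)`
  obtain ⟨uE, ωE, huE, huEi, -, hME, hMEneg, hωE, hωE0, hGE, htop, hψ2, hψ2neg⟩ :=
    cmCurve_rationalModel hE hd hψ
  obtain ⟨t, ht⟩ := htop η hη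
  have hηt : η = ((t : ℚ) : ℂ) • ωE := ht
  set ME : Matrix (Fin 2) (Fin 2) ℚ := !![(0 : ℚ), -(d : ℚ); 1, 0] with hMEdef
  set GE : Matrix (Fin 2) (Fin 2) ℚ := !![(0 : ℚ), 1; -1, 0] with hGEdef
  have hMEsq : ∀ w : Fin 2 → ℚ, ME.mulVec (ME.mulVec w) = -((d : ℚ) • w) := by
    intro w
    ext i
    fin_cases i <;> simp [hMEdef, Matrix.mulVec, dotProduct, Fin.sum_univ_two]
  have hGEt : ∀ x y : Fin 2 → ℚ, y ⬝ᵥ GE.mulVec x = -(x ⬝ᵥ GE.mulVec y) := by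
    intro x y
    simp [hGEdef, Matrix.mulVec, dotProduct, Fin.sum_univ_two]
    ring
  have hv₀ : (Pi.single 0 1 : Fin 2 → ℚ) ≠ 0 := by
    intro h0
    have := congrFun h0 0
    simp at this
  -- the aiming arithmetic (all cases)
  set κ₂ : ℚ := ((2 * n + 1).choose (j + 1) : ℚ) * dA * (2 * d * t) with hκ₂
  set κ₁ : ℚ := ((2 * n + 1).choose j : ℚ) * (2 * (2 * d * t) * (2 * d * t)) with hκ₁
  obtain ⟨m₁, m₂, hm₁, hm₂, b, hb, hbM, hbG⟩ :=
    exists_isotropic_blockVectors' hdq M hMA G hGt hWA n hcard hPN ME hMEsq GE hGEt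
      (Pi.single 0 1) hv₀ κ₁ κ₂
  refine ⟨m₁, m₂, hm₁, hm₂, ?_⟩
  -- the model of `B = E₀ × E₀`: frame, operator, Gram matrix, top power
  set Xf := (complexBetti.map (AbelianVariety.fst E₀ E₀).hom.hom.hom 1) with hXf
  set Yf := (complexBetti.map (AbelianVariety.snd E₀ E₀).hom.hom.hom 1) with hYf
  set w : Fin 2 ⊕ Fin 2 → complexBetti B.X 1 :=
    Sum.elim (fun i => Xf (uE i)) (fun i => Yf (uE i)) with hw
  have hwrat : ∀ k, IsRationalClass (w k) := by
    rintro (i | i)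
    · exact (huE i).map _
    · exact (huE i).map _
  have hwi : LinearIndependent ℂ w := linearIndependent_sumElim_map_fst_map_snd huEi huEi
  have hMB : ∀ k, complexBetti.map ΦB.hom.hom.hom 1 (w k) =
      ∑ l, ((Matrix.fromBlocks ME 0 0 (-ME) l k : ℚ) : ℂ) • w l :=
    fun k ↦ map_prodLift_sumElim ψ₀ (-ψ₀) uE ME hME uE (-ME) hMEneg k
  -- the factor classes `h₁ = 2dm₁ η`, `h₂ = 2dm₂ η`
  set d₁ : ℚ := 2 * d * m₁ * t with hd₁
  set d₂ : ℚ := 2 * d * m₂ * t with hd₂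
  set h₁ : complexBetti E₀.X 2 := ((2 * d * m₁ : ℚ) : ℂ) • η with hh₁
  set h₂ : complexBetti E₀.X 2 := ((2 * d * m₂ : ℚ) : ℂ) • η with hh₂
  have hd₁' : lefschetzPow h₁ 0 2 h₁ = ((d₁ : ℚ) : ℂ) • ωE := by
    change h₁ = _
    rw [hh₁, hηt, smul_smul, hd₁]
    push_cast
    ring_nf
  have hd₂' : lefschetzPow h₂ 0 2 h₂ = ((d₂ : ℚ) : ℂ) • ωE := by
    change h₂ = _
    rw [hh₂, hηt, smul_smul, hd₂]
    push_cast
    ring_nf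
  set hBcls : complexBetti B.X 2 := complexBetti.map (AbelianVariety.fst E₀ E₀).hom.hom.hom 2 h₁ +
    complexBetti.map (AbelianVariety.snd E₀ E₀).hom.hom.hom 2 h₂ with hhBcls
  set ωB : complexBetti B.X (2 + 2 * 1) :=
    cupProduct (by omega : (2 + 2 * 0) + (2 + 2 * 0) = 2 + 2 * 1)
      (complexBetti.map (AbelianVariety.fst E₀ E₀).hom.hom.hom (2 + 2 * 0) ωE)
      (complexBetti.map (AbelianVariety.snd E₀ E₀).hom.hom.hom (2 + 2 * 0) ωE) with hωB
  set GB : Matrix (Fin 2 ⊕ Fin 2) (Fin 2 ⊕ Fin 2) ℚ :=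
    Matrix.fromBlocks ((((1 : ℕ).choose 0 : ℚ) * d₂) • GE) 0 0 ((((1 : ℕ).choose (0 + 1) : ℚ) * d₁) • GE)
    with hGB
  have hGB' : ∀ s s', Motives.polarizationPairingOne B.X hBcls 1 (w s) (w s') = ((GB s s' : ℚ) : ℂ) • ωB :=
    fun s s' ↦ polarizationPairingOne_sumElim (jA := 0) (jB := 0) (m := 1) hE hE rfl uE uE h₁ ωE GE
      (hGE h₁) d₁ hd₁' h₂ ωE GE (hGE h₂) d₂ hd₂' s s'
  set dB : ℚ := ((1 + 1).choose (0 + 1) : ℚ) * d₁ * d₂ with hdB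
  have hdB' : lefschetzPow hBcls 1 2 hBcls = ((dB : ℚ) : ℂ) • ωB :=
    lefschetzPow_add_map_self (jA := 0) (jB := 0) (m := 1) hE hE rfl h₁ ωE d₁ hd₁' h₂ ωE d₂ hd₂'
  -- the block Gram matrix of `A × B` is the one of the aiming arithmetic
  have hmat : Matrix.fromBlocks ((((2 * (n + 1) - 1).choose j : ℚ) * dB) • G) 0 0
      ((((2 * (n + 1) - 1).choose (j + 1) : ℚ) * dA) • GB) =
      Matrix.fromBlocks ((κ₁ * m₁ * m₂) • G) 0 0
        (Matrix.fromBlocks ((κ₂ * m₂) • GE) 0 0 ((κ₂ * m₁) • GE)) := by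
    have e21 : 2 * (n + 1) - 1 = 2 * n + 1 := by omega
    rw [e21, hGB, Matrix.fromBlocks_smul, smul_zero, smul_smul, smul_smul]
    congr 1
    · congr 1
      rw [hκ₁, hdB, hd₁, hd₂]
      push_cast
      simp [Nat.choose]
      ring
    · congr 1
      · congr 1
        rw [hκ₂, hd₂]
        simp [Nat.choose]
        ring
      · congr 1
        rw [hκ₂, hd₁]
        simp [Nat.choose]
        ring
  have hbG' : ∀ k l, ∑ s, ∑ s', b k s *
      (Matrix.fromBlocks ((((2 * (n + 1) - 1).choose j : ℚ) * dB) • G) 0 0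
        ((((2 * (n + 1) - 1).choose (j + 1) : ℚ) * dA) • GB)) s s' * b l s' = 0 := by
    intro k l
    rw [hmat]
    exact hbG k l
  -- the hyperbolic frame of `A × B`
  have hhyp := isHyperbolicWeilType_prod_of_rationalModels (A := A) (B := B) (φ := φ) (ψ := ΦB)
    (jA := j) (jB := 1) (N := n + 1) hA hBdim (by omega) u hu hui M hM w hwrat hwi
    (Matrix.fromBlocks ME 0 0 (-ME)) hMB h ω G hG dA hdA hBcls ωB GB hGB' dB hdB' b hb hbM hbG'
  -- the class: `d·K + Φ^*K = pr_A^* h + pr_B^* h_B`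
  have hclsB : (d : ℂ) • ((m₁ : ℂ) • complexBetti.map (AbelianVariety.fst E₀ E₀).hom.hom.hom 2 η +
        (m₂ : ℂ) • complexBetti.map (AbelianVariety.snd E₀ E₀).hom.hom.hom 2 η) +
      complexBetti.map ΦB.hom.hom.hom 2
        ((m₁ : ℂ) • complexBetti.map (AbelianVariety.fst E₀ E₀).hom.hom.hom 2 η +
          (m₂ : ℂ) • complexBetti.map (AbelianVariety.snd E₀ E₀).hom.hom.hom 2 η) = hBcls := by
    have e1 : (m₁ : ℂ) • complexBetti.map (AbelianVariety.fst E₀ E₀).hom.hom.hom 2 η =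
        complexBetti.map (AbelianVariety.fst E₀ E₀).hom.hom.hom 2 ((m₁ : ℂ) • η) := by rw [map_smul]
    have e2 : (m₂ : ℂ) • complexBetti.map (AbelianVariety.snd E₀ E₀).hom.hom.hom 2 η =
        complexBetti.map (AbelianVariety.snd E₀ E₀).hom.hom.hom 2 ((m₂ : ℂ) • η) := by rw [map_smul]
    rw [e1, e2, hΦB, smul_add_map_prodLift ψ₀ (-ψ₀) (d : ℂ) ((m₁ : ℂ) • η) ((m₂ : ℂ) • η)]
    have f1 : (d : ℂ) • ((m₁ : ℂ) • η) + complexBetti.map ψ₀.hom.hom.hom 2 ((m₁ : ℂ) • η) = h₁ := by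
      rw [map_smul]
      change (d : ℂ) • ((m₁ : ℂ) • η) + (m₁ : ℂ) • complexBetti.map ψ₀.hom.hom.hom (2 + 2 * 0) η = h₁
      rw [hψ2 η, hh₁, smul_smul, smul_smul, ← add_smul]
      push_cast
      ring_nf
    have f2 : (d : ℂ) • ((m₂ : ℂ) • η) + complexBetti.map (-ψ₀).hom.hom.hom 2 ((m₂ : ℂ) • η) = h₂ := by
      rw [map_smul]
      change (d : ℂ) • ((m₂ : ℂ) • η) + (m₂ : ℂ) • complexBetti.map (-ψ₀).hom.hom.hom (2 + 2 * 0) η = h₂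
      rw [hψ2neg η, hh₂, smul_smul, smul_smul, ← add_smul]
      push_cast
      ring_nf
    rw [f1, f2]
  have hcls : (d : ℂ) • (complexBetti.map (AbelianVariety.fst A B).hom.hom.hom 2 H +
        complexBetti.map (AbelianVariety.snd A B).hom.hom.hom 2
          ((m₁ : ℂ) • complexBetti.map (AbelianVariety.fst E₀ E₀).hom.hom.hom 2 η +
            (m₂ : ℂ) • complexBetti.map (AbelianVariety.snd E₀ E₀).hom.hom.hom 2 η)) +
      complexBetti.map (AbelianVariety.prodLift (AbelianVariety.fst A B ≫ φ)
        (AbelianVariety.snd A B ≫ ΦB)).hom.hom.hom 2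
        (complexBetti.map (AbelianVariety.fst A B).hom.hom.hom 2 H +
          complexBetti.map (AbelianVariety.snd A B).hom.hom.hom 2
            ((m₁ : ℂ) • complexBetti.map (AbelianVariety.fst E₀ E₀).hom.hom.hom 2 η +
              (m₂ : ℂ) • complexBetti.map (AbelianVariety.snd E₀ E₀).hom.hom.hom 2 η)) =
      complexBetti.map (AbelianVariety.fst A B).hom.hom.hom 2 h +
        complexBetti.map (AbelianVariety.snd A B).hom.hom.hom 2 hBcls := by
    rw [smul_add_map_prodLift φ ΦB (d : ℂ) H, ← hclsB]
  rw [hcls]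
  exact hhyp

/-- **The partner-surface lemma for `(A₁, φ₁)`, from its three inputs** — the conclusion of
`exists_weilTypeSurface_prod_isHyperbolicWeilType_all` for a given Weil-type `(A₁, φ₁)`
(`dim A₁ = j + 1 = 2n`, `φ₁ ≫ φ₁ = -d`), PROVED from: (G4) a CM curve `(E₀, ψ₀)` (`dim E₀ = 1`,
`ψ₀ ≫ ψ₀ = -d`); (G1/G2) a rational class `H` on `A₁` together with a rational degree-one model
of `(A₁, φ₁, d·H + φ₁^*H)` of signature `(2n, 2n)` (for `H` a hyperplane class this is
Hodge–Riemann in degree one, van Geemen 5.2 (4)); (G3) for all weights `m₁, m₂ ≥ 1`, a projective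
embedding `e` of `A₁ × (E₀ × E₀)` and a rational `a ≠ 0` with
`e^* a = pr_A^* H + pr_B^*(m₁ pr₁^*η + m₂ pr₂^*η)` (weighted Segre embeddings). The partner is
`A₂ = E₀ × E₀`, `φ₂ = ψ₀ × (-ψ₀)` with its Weil classes AND Schoen's descent partner `t`
(`exists_weilType_cmSquare_partner`: the Weil lines of the CM square are algebraic, file
`WeilSurfaceCMSquareAlgebraic`), the hyperbolicity is `isHyperbolicWeilType_prod_cmSquare_of_signature`. None of (G2)–(G4) is in the tree; this theorem
records exactly what remains. [cite: Markman2025SurveySecant, §11.5 Step 2]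
[cite: vanGeemen1994HodgeAV, Lemma 5.2 (2)–(4), 5.3 and 5.4 (5.4.1)] [cite: Schoen1998HodgeWeilAddendum, §10] -/
theorem exists_weilTypeSurface_prod_isHyperbolicWeilType_of_inputs
    {n d : ℕ} (hd : 0 < d) {A₁ : Motives.AbelianVariety ℂ} {φ₁ : A₁ ⟶ A₁} {j : ℕ}
    (hA : A₁.dim = j + 1) (hj : j + 1 = 2 * n) (hφ₁ : φ₁ ≫ φ₁ = -(d • 𝟙 A₁))
    (hE : E₀.dim = 1) (hψ : ψ₀ ≫ ψ₀ = -(d • 𝟙 E₀)) (η : complexBetti E₀.X 2) (hη : IsRationalClass η)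
    (H : complexBetti A₁.X 2)
    {ι : Type} [Fintype ι] [DecidableEq ι]
    (u : ι → complexBetti A₁.X 1) (hu : ∀ i, IsRationalClass (u i)) (hui : LinearIndependent ℂ u)
    (hus : Submodule.span ℂ (Set.range u) = ⊤) (M : Matrix ι ι ℚ)
    (hM : ∀ i, complexBetti.map φ₁.hom.hom.hom 1 (u i) = ∑ a, ((M a i : ℚ) : ℂ) • u a)
    (ω : complexBetti A₁.X (2 + 2 * j)) (hω0 : ω ≠ 0) (G : Matrix ι ι ℚ)
    (hG : ∀ i k, Motives.polarizationPairingOne A₁.X ((d : ℂ) • H + complexBetti.map φ₁.hom.hom.hom 2 H) j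
      (u i) (u k) = ((G i k : ℚ) : ℂ) • ω)
    (dA : ℚ) (hdA : lefschetzPow ((d : ℂ) • H + complexBetti.map φ₁.hom.hom.hom 2 H) j 2
      ((d : ℂ) • H + complexBetti.map φ₁.hom.hom.hom 2 H) = ((dA : ℚ) : ℂ) • ω)
    (hPN : ∃ P N : Submodule ℚ (ι → ℚ), (∀ v ∈ P, M.mulVec v ∈ P) ∧ (∀ v ∈ N, M.mulVec v ∈ N) ∧
      Module.finrank ℚ P = 2 * n ∧ Module.finrank ℚ N = 2 * n ∧ P ⊓ N = ⊥ ∧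
      (∀ x ∈ P, x ≠ 0 → 0 < x ⬝ᵥ G.mulVec (M.mulVec x)) ∧
      (∀ x ∈ N, x ≠ 0 → x ⬝ᵥ G.mulVec (M.mulVec x) < 0))
    (hSeg : ∀ m₁ m₂ : ℕ, 0 < m₁ → 0 < m₂ →
      ∃ (e : Motives.ProjectiveEmbedding (A₁.prod (E₀.prod E₀)).X)
        (a : complexBetti (Motives.projectiveSpace e.n ℂ) 2), IsRationalClass a ∧ a ≠ 0 ∧
        complexBetti.map e.ι 2 a =
          complexBetti.map (AbelianVariety.fst A₁ (E₀.prod E₀)).hom.hom.hom 2 H +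
            complexBetti.map (AbelianVariety.snd A₁ (E₀.prod E₀)).hom.hom.hom 2
              ((m₁ : ℂ) • complexBetti.map (AbelianVariety.fst E₀ E₀).hom.hom.hom 2 η +
                (m₂ : ℂ) • complexBetti.map (AbelianVariety.snd E₀ E₀).hom.hom.hom 2 η)) :
    ∃ (A₂ : Motives.AbelianVariety ℂ) (φ₂ : A₂ ⟶ A₂), A₂.dim = 2 * 1 ∧
      Motives.IsSmoothProjective (2 * 1) A₂.X ∧ φ₂ ≫ φ₂ = -(d • 𝟙 A₂) ∧
      (∃ up um : complexBetti A₂.X (2 * 1), up ∈ weilClassesPlus A₂ φ₂ 1 d ∧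
        um ∈ weilClassesMinus A₂ φ₂ 1 d ∧ IsRationalClass (up + um) ∧
        IsOfHodgeType (2 * 1) A₂.X (2 * 1) 1 1 (up + um) ∧ up ≠ 0 ∧ um ≠ 0 ∧
        ∃ t : complexBetti A₂.X (2 * 1), t ∈ algebraicClasses A₂.X 1 ∧
          cupProduct (show 2 * 1 + 2 * 1 = 2 * (2 * 1) from rfl) up t ≠ 0 ∧
          cupProduct (show 2 * 1 + 2 * 1 = 2 * (2 * 1) from rfl) um t ≠ 0) ∧
      ∃ (e : Motives.ProjectiveEmbedding (A₁.prod A₂).X)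
        (a : complexBetti (Motives.projectiveSpace e.n ℂ) 2), IsRationalClass a ∧ a ≠ 0 ∧
        Motives.IsHyperbolicWeilType (A₁.prod A₂)
          (Motives.AbelianVariety.prodLift (Motives.AbelianVariety.fst A₁ A₂ ≫ φ₁)
            (Motives.AbelianVariety.snd A₁ A₂ ≫ φ₂)) (n + 1)
          ((d : ℂ) • complexBetti.map e.ι 2 a +
            complexBetti.map (Motives.AbelianVariety.prodLift
              (Motives.AbelianVariety.fst A₁ A₂ ≫ φ₁)
              (Motives.AbelianVariety.snd A₁ A₂ ≫ φ₂)).hom.hom.hom 2 (complexBetti.map e.ι 2 a)) := by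
  obtain ⟨h1, h2, h3, h4⟩ := exists_weilType_cmSquare_partner hE hd hψ
  obtain ⟨m₁, m₂, hm₁, hm₂, hhyp⟩ := isHyperbolicWeilType_prod_cmSquare_of_signature hd hA hj hφ₁ H
    hE hψ η hη u hu hui hus M hM ω hω0 G hG dA hdA hPN
  obtain ⟨e, a, ha, ha0, hea⟩ := hSeg m₁ m₂ hm₁ hm₂
  refine ⟨E₀.prod E₀, _, h1, h2, h3, h4, e, a, ha, ha0, ?_⟩
  rw [hea]
  exact hhyp

end Assembly

end Literature.AlgebraicGeometry.HodgeTheory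

end
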